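import Summits.Ventures.PercRepro.Night2LocalTwoColoop

/-!
# PercRepro — the case split of the local form at a plane, and `ShadowHall M 4 2` modulo the line case
(night-2, gen 7)

For a plane `G` (rank-`3` flat) and the diagonal `q = 2`, the carrying lines `F = cl B` (`B ∈ Uq M 4 2`,
`cl B ⊆ G`) have `|E ∖ F| ≥ 2`, and `|E ∖ F| = |G ∖ F| + |E ∖ G|` (`card_compl_clF_add`).  The local form
`LocalShadowHall M 2 G` is in the tree in every case but one:

* (A) some carrying line has `|E ∖ F| = 2`: `localShadowHall_of_exists_two`;
* (B) every carrying line has `|E ∖ F| ≥ 4`: `localShadowHall_of_thin`;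
* otherwise some carrying line has `|E ∖ F| = 3` and `|E ∖ G| ∈ {1, 2}`:
  * (C2) `|E ∖ G| = 1`: every carrying line then has `|G ∖ F| ≥ 2`: `localShadowHall_two_of_card_compl_one`;
  * (C1) `|E ∖ G| = 2` with a carrying line `F = G ∖ {z}`: **`LineCaseTwo M`**, the statement of the LINE CASE
    (`proofs/NIGHT-2-local.md` §7, the 2-adic fractional matching on paper).

**`localShadowHall_two_of_lineCase`** and **`shadowHall_four_two_of_lineCase`**: modulo `LineCaseTwo M`, the local
form holds at every plane and `ShadowHall M 4 2 (phiK 4 2)` — the diagonal shadow form of C-025 at `q = 2`, for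
every finite matroid.  The exact remaining gap of the `q = 2` row of the shadow form in the kernel is thus
`LineCaseTwo M` for every finite matroid `M`.
-/

namespace PercRepro.Shadow

open Finset PerFlat ThmH

variable {α : Type*} [DecidableEq α] {M : Matroid α} [M.Finite]

/-- `|E ∖ cl B| = |G ∖ cl B| + |E ∖ G|` for a member inside the flat `G`. -/
theorem card_compl_clF_add {q : ℕ} {G : Finset α} (hG : G ∈ flatsQ M (q + 1)) {B : Finset α}
    (hBG : clF M B ⊆ G) : (gr M \ clF M B).card = (G \ clF M B).card + (gr M \ G).card := by
  have hGg : G ⊆ gr M := (mem_flatsQ.1 hG).1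
  have hu : gr M \ G ∪ G \ clF M B = gr M \ clF M B := Finset.sdiff_union_sdiff_cancel hGg hBG
  have hdisj : Disjoint (gr M \ G) (G \ clF M B) := by
    rw [Finset.disjoint_left]
    intro x hx hx'
    exact (Finset.mem_sdiff.1 hx).2 (Finset.mem_sdiff.1 hx').1
  rw [← hu, Finset.card_union_eq_card_add_card.2 hdisj]
  ring

/-- A member has at least one element of a rank-`(q + 1)` flat `G` outside its closure (the ranks differ). -/
theorem one_le_card_sdiff_clF {q : ℕ} {G : Finset α} (hG : G ∈ flatsQ M (q + 1)) {B : Finset α}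
    (hB : B ∈ Uq M (q + 2) q) : 1 ≤ (G \ clF M B).card := by
  rw [Nat.one_le_iff_ne_zero, Ne, Finset.card_eq_zero, Finset.sdiff_eq_empty_iff_subset]
  intro hGF
  have hFq : clF M B ∈ flatsQ M q := clF_mem_flatsQ hB
  have h : M.eRk (G : Set α) ≤ (q : ℕ∞) := by
    rw [← (mem_flatsQ.1 hFq).2.2]
    exact M.eRk_mono (by exact_mod_cast hGF)
  rw [(mem_flatsQ.1 hG).2.2] at h
  have : q + 1 ≤ q := by exact_mod_cast h
  omega

/-- A member forces a ground element outside a rank-`(q + 1)` flat `G` (its complement has rank `q + 2`). -/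
theorem one_le_card_compl_of_member {q : ℕ} {G : Finset α} (hG : G ∈ flatsQ M (q + 1)) {B : Finset α}
    (hB : B ∈ Uq M (q + 2) q) : 1 ≤ (gr M \ G).card := by
  rw [Nat.one_le_iff_ne_zero, Ne, Finset.card_eq_zero, Finset.sdiff_eq_empty_iff_subset]
  intro hEG
  have h : M.eRk ((gr M \ B : Finset α) : Set α) ≤ ((q + 1 : ℕ) : ℕ∞) := by
    rw [← (mem_flatsQ.1 hG).2.2]
    exact M.eRk_mono (by exact_mod_cast Finset.sdiff_subset.trans hEG)
  rw [(mem_Uq.1 hB).2.2] at h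
  have : q + 2 ≤ q + 1 := by exact_mod_cast h
  omega

/-- **The line case at `q = 2`** (case (C1) of `proofs/NIGHT-2-local.md` §7–§8): at a plane `G` with exactly two
ground elements outside it, carrying a line `F` with `|E ∖ F| = 3` (so `F = G ∖ {z}`) and no carrying line with
`|E ∖ F| = 2`, the local form holds.  A statement, not yet a theorem of the tree. -/
def LineCaseTwo (M : Matroid α) [M.Finite] : Prop :=
  ∀ G ∈ flatsQ M (2 + 1), (gr M \ G).card = 2 →
    (∃ B₀ ∈ Uq M (2 + 2) 2, clF M B₀ ⊆ G ∧ (gr M \ clF M B₀).card = 3) →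
    (∀ B ∈ Uq M (2 + 2) 2, clF M B ⊆ G → 3 ≤ (gr M \ clF M B).card) → LocalShadowHall M 2 G

/-- **The case split at a plane**: modulo the line case, the local form holds at every plane. -/
theorem localShadowHall_two_of_lineCase (hline : LineCaseTwo M) {G : Finset α} (hG : G ∈ flatsQ M (2 + 1)) :
    LocalShadowHall M 2 G := by
  classical
  -- (A) a carrying line with |E ∖ F| = 2
  rcases em (∃ B₀ ∈ Uq M (2 + 2) 2, clF M B₀ ⊆ G ∧ (gr M \ clF M B₀).card = 2) with hA | hnA
  · exact localShadowHall_of_exists_two hG hA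
  have h3 : ∀ B ∈ Uq M (2 + 2) 2, clF M B ⊆ G → 3 ≤ (gr M \ clF M B).card := by
    intro B hB hBG
    have h2 := two_le_card_compl_clF hB
    by_contra hlt
    exact hnA ⟨B, hB, hBG, by omega⟩
  -- (B) every carrying line thin
  rcases em (∃ B₀ ∈ Uq M (2 + 2) 2, clF M B₀ ⊆ G ∧ (gr M \ clF M B₀).card = 3) with hC | hnC
  · obtain ⟨B₀, hB₀, hB₀G, hc₀⟩ := hC
    have hsum := card_compl_clF_add hG hB₀G
    have h1 := one_le_card_sdiff_clF hG hB₀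
    have hd1 := one_le_card_compl_of_member hG hB₀
    rcases Nat.lt_or_ge (gr M \ G).card 2 with hd | hd
    · -- (C2): |E ∖ G| = 1
      have hd' : (gr M \ G).card = 1 := by omega
      apply localShadowHall_two_of_card_compl_one hG hd'
      intro B hB hBG
      have := card_compl_clF_add hG hBG
      have := h3 B hB hBG
      omega
    · -- (C1): |E ∖ G| = 2
      have hd' : (gr M \ G).card = 2 := by omega
      exact hline G hG hd' ⟨B₀, hB₀, hB₀G, hc₀⟩ h3
  · apply localShadowHall_of_thin hG
    intro B hB hBG
    have := h3 B hB hBG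
    by_contra hlt
    exact hnC ⟨B, hB, hBG, by omega⟩

/-- **`ShadowHall M 4 2` modulo the line case**: the diagonal shadow form of C-025 at `q = 2` for every finite
matroid, given `LineCaseTwo M`. -/
theorem shadowHall_four_two_of_lineCase (hline : LineCaseTwo M) : ShadowHall M 4 2 (phiK 4 2) := by
  have h := shadowHall_of_local (M := M) (q := 2) (fun G hG => localShadowHall_two_of_lineCase hline hG)
  rw [GenQ.phiK_succ_succ 2]
  exact h

end PercRepro.Shadow
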